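import Literature.NumberTheory.LFunctions.DeBruijnHXiHeatRay
import Literature.NumberTheory.LFunctions.XiStripHeightSup
import Literature.NumberTheory.LFunctions.XiHeatRayGaussian
import HarnessLib

/-!
# The integrand of the heat ray `𝒜_t(σ + iT)` around its Laplace point

Fourth file of the in-tree proof of `Literature.NumberTheory.LFunctions.ki_kim_lee_finite`
(Ki–Kim–Lee, Adv. Math. 222 (2009), Thm. 1.3: for every `t > 0` all but finitely many zeros of
`H_t` are real; the Hermite–Biehler reduction to the strict monotonicity of
`σ ↦ |𝒜_t(σ + iT)|`, `𝒜_t(s) = ∫_0^∞ e^{-u²/t} ξ(s + u) du`, is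
`Literature.NumberTheory.LFunctions.ki_kim_lee_finite_of_strictMonoOn_xiHeatRay` in
`DeBruijnHXiHeatRay.lean`). Everything here is proved; the file also collects the definitions
used by the two files completing the proof (`XiHeatRayLaplace.lean`, `XiHeatRayMonotone.lean`).

Write `ℓ = ℓ_T = ½ log(T/2π)` (`Literature.NumberTheory.LFunctions.xiRayEll`, the real part of
the model value `κ_T = ℓ + iπ/4` of `ξ'/ξ` on the ray at height `T`, `XiHorizontalLogDeriv.lean`;
Polymath 15, Lemma 9.2) and `u₀ = tℓ/2` (`Literature.NumberTheory.LFunctions.xiLaplacePt`). The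
integrand of `𝒜_t(σ + iT)` is
`Literature.NumberTheory.LFunctions.xiHeatRayIntegrand t T σ u = e^{-u²/t} ξ(σ + iT + u)`.
Since `|ξ(σ + u + iT)| ≈ e^{ℓu}` along the ray, the weight `e^{-u²/t + ℓu}` peaks at `u = u₀`;
completing the square (`-u²/t + ℓ(u − u₀) = -u₀²/t − (u − u₀)²/t`,
`Literature.NumberTheory.LFunctions.laplacePt_complete_square`) and the two-point control of `ξ`
along the ray (`Literature.NumberTheory.LFunctions.riemannXi_horizontal_two_point`) give, with
`c = σ + u₀`, `y = u − u₀` and the scale `K = e^{-u₀²/t} ξ(c + iT)`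
(`Literature.NumberTheory.LFunctions.xiLaplaceScale`):

* `Literature.NumberTheory.LFunctions.xiHeatRayIntegrand_window` — on the window `|y| ≤ Y`
  (`u > 5`): `e^{-u²/t} ξ(σ+u+iT) = K · exp(−y²/t + iπy/4 + ρ)` with `‖ρ‖ ≤ η₂ |y|`,
  `η₂ = η_T + (c + Y)/(2T)` (`η_T = 0.0824 + 4/T`, `Literature.NumberTheory.LFunctions.xiRayErr`);
* `Literature.NumberTheory.LFunctions.norm_xiHeatRayIntegrand_le_of_window`,
  `Literature.NumberTheory.LFunctions.norm_xiHeatRayIntegrand_sub_model_le_of_window` — there,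
  `‖e^{-u²/t} ξ(σ+u+iT)‖ ≤ ‖K‖ e^{η₂² t} e^{-3y²/(4t)}` and
  `‖e^{-u²/t} ξ(σ+u+iT) − K e^{-y²/t + iπy/4}‖ ≤ ‖K‖ η₂ e^{η₂² t} |y| e^{-3y²/(4t)}`;
* `Literature.NumberTheory.LFunctions.norm_xiHeatRayIntegrand_le_of_tail` — beyond the window
  (`y ≥ Y ≥ 4t(η_T + 1)`): `‖e^{-u²/t} ξ(σ+u+iT)‖ ≤ ‖K‖ e^{-y²/(2t)}`;
* `Literature.NumberTheory.LFunctions.norm_riemannXi_five_le_laplace` — the strip scale is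
  negligible: `|ξ(σ + 5 + iT)| ≤ ‖K‖ · exp(u₀²/t − (ℓ − η_T − c/(2T)) (u₀ − 5))`.

The last section defines the remaining quantities of the Laplace analysis (the two parts
`Literature.NumberTheory.LFunctions.xiHeatRayInit` / `Literature.NumberTheory.LFunctions.xiHeatRayMain`
of the ray integral split at `u = 5`, the Gaussian-phase model, the dominating profiles
`Literature.NumberTheory.LFunctions.xiWindowBound`, `Literature.NumberTheory.LFunctions.xiDiffBound`,
the brackets `Literature.NumberTheory.LFunctions.xiMainLower`, `Literature.NumberTheory.LFunctions.xiDiffInt`,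
`Literature.NumberTheory.LFunctions.xiInitRate`, and the hypothesis bundles
`Literature.NumberTheory.LFunctions.LaplaceHyp`, `Literature.NumberTheory.LFunctions.RegimeHyp`).

On provenance: the statement proved at the end of this chain is Ki–Kim–Lee's Thm. 1.3 (reality
part). Their printed proof (op. cit.; per H. Ki, *Zeros of zeta functions* (2011), remarks after
Thm. 3.7, "saddle point methods together with" Ki–Kim's theorem on de Bruijn's question) and
Polymath 15's effective refinement (Res. Math. Sci. 6 (2019), Thm. 1.5 (i), proved in §9 from the
Riemann–Siegel-type estimates of their Thm. 1.3 and the argument principle) are organised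
differently; the in-tree argument only uses the heat-kernel representation (Polymath 15, eq. (30)),
`ξ'/ξ = ½ log(T/2π) + iπ/4 + O(1)` on `Re s ≥ 5` (cf. Polymath 15, Lemma 9.2) and crude bounds
for `ξ` in the strip, and all intermediate estimates below are tagged `[folklore]` (standard
Laplace-method bookkeeping) rather than attributed to either source.

## References

* H. Ki, Y.-O. Kim, J. Lee, *On the de Bruijn–Newman constant*, Adv. Math. 222 (2009) 281–306,
  Thm. 1.3.
* D. H. J. Polymath, *Effective approximation of heat flow evolution of the Riemann ξ function,
  and a new upper bound for the de Bruijn–Newman constant*, Res. Math. Sci. 6 (2019) 31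
  (arXiv:1904.12438), §4 eq. (30), §9 (Prop. 9.1, Lemma 9.2), Thm. 1.5 (i).
-/

noncomputable section

open Complex Filter Set MeasureTheory
open scoped Real

namespace Literature.NumberTheory.LFunctions

/-! ## The Laplace point -/

/-- `ℓ_T = ½ log(T/(2π))`, the real part of the model value `κ_T` of `ξ'/ξ` on the horizontal ray
at height `T` (Polymath 15, Lemma 9.2: `M_t'/M_t = ½ log(x/4π) + iπ/4 + o(1)` at
`s = ix/2 + O(1)`, i.e. height `T = x/2`). [cite: Polymath2019, §9 Lemma 9.2] -/
def xiRayEll (T : ℝ) : ℝ := Real.log (T / (2 * π)) / 2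

/-- `Re κ_T = ℓ_T`. [folklore] -/
@[simp] theorem xiLogDerivModel_re_eq (T : ℝ) : (xiLogDerivModel T).re = xiRayEll T := by
  simp [xiRayEll]

/-- `κ_T = ℓ_T + iπ/4`. [folklore] -/
theorem xiLogDerivModel_eq_ell (T : ℝ) :
    xiLogDerivModel T = ((xiRayEll T : ℝ) : ℂ) + ((π / 4 : ℝ) : ℂ) * I := by
  simp [xiLogDerivModel, xiRayEll]

/-- `ℓ_T ≥ 0` for `T ≥ 2π`. [folklore] -/
theorem xiRayEll_nonneg {T : ℝ} (hT : 2 * π ≤ T) : 0 ≤ xiRayEll T := by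
  rw [xiRayEll]
  have : 1 ≤ T / (2 * π) := by rw [le_div_iff₀ (by positivity)]; linarith
  have := Real.log_nonneg this
  linarith

/-- `‖κ_T‖ ≤ ℓ_T + 1` for `T ≥ 2π`. [folklore] -/
theorem norm_xiLogDerivModel_le {T : ℝ} (hT : 2 * π ≤ T) : ‖xiLogDerivModel T‖ ≤ xiRayEll T + 1 := by
  rw [xiLogDerivModel_eq_ell]
  refine (norm_add_le _ _).trans ?_
  have h1 : ‖((xiRayEll T : ℝ) : ℂ)‖ = xiRayEll T := by
    rw [Complex.norm_real, Real.norm_eq_abs, abs_of_nonneg (xiRayEll_nonneg hT)]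
  have h2 : ‖((π / 4 : ℝ) : ℂ) * I‖ ≤ 1 := by
    rw [norm_mul, Complex.norm_I, mul_one, Complex.norm_real, Real.norm_eq_abs,
      abs_of_nonneg (by positivity)]
    linarith [Real.pi_lt_d2]
  linarith

/-- The Laplace point `u₀ = t ℓ_T / 2` of the weight `e^{-u²/t + ℓ_T u}`. [folklore] -/
def xiLaplacePt (t T : ℝ) : ℝ := t * xiRayEll T / 2

/-- `ℓ_T = 2u₀/t`. [folklore] -/
theorem xiRayEll_eq_laplacePt {t : ℝ} (ht : t ≠ 0) (T : ℝ) : xiRayEll T = 2 * xiLaplacePt t T / t := by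
  rw [xiLaplacePt]; field_simp

/-- **Completing the square at the Laplace point**: `-u²/t + ℓ (u − u₀) = -u₀²/t − (u − u₀)²/t`.
[folklore] -/
theorem laplacePt_complete_square {t : ℝ} (ht : t ≠ 0) (T u : ℝ) :
    -u ^ 2 / t + xiRayEll T * (u - xiLaplacePt t T) =
      -(xiLaplacePt t T ^ 2 / t) - (u - xiLaplacePt t T) ^ 2 / t := by
  rw [xiRayEll_eq_laplacePt ht T]
  field_simp
  ring

/-! ## The integrand of the heat ray -/

/-- The integrand of `𝒜_t(σ + iT)`: `e^{-u²/t} ξ(σ + iT + u)` (syntactically the integrand of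
`Literature.NumberTheory.LFunctions.xiHeatRay t (σ + iT)`). [cite: Polymath2019, §4 eq. (30)] -/
def xiHeatRayIntegrand (t T σ u : ℝ) : ℂ :=
  (Real.exp (-u ^ 2 / t) : ℂ) * riemannXi ((σ : ℂ) + T * I + u)

/-- `𝒜_t(σ + iT) = ∫_0^∞ (xiHeatRayIntegrand t T σ)`. [folklore] -/
theorem xiHeatRay_eq_integral_integrand (t T σ : ℝ) :
    xiHeatRay t ((σ : ℂ) + T * I) = ∫ u in Ioi (0 : ℝ), xiHeatRayIntegrand t T σ u := rfl

/-- The integrand is integrable over `ℝ` for `t > 0`. [folklore] -/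
theorem integrable_xiHeatRayIntegrand {t : ℝ} (ht : 0 < t) (T σ : ℝ) :
    Integrable (xiHeatRayIntegrand t T σ) :=
  integrable_xiHeatRay_integrand ht _

/-- The integrand is continuous in `u`. [folklore] -/
theorem continuous_xiHeatRayIntegrand (t T σ : ℝ) : Continuous (xiHeatRayIntegrand t T σ) := by
  have : Continuous riemannXi := differentiable_riemannXi.continuous
  unfold xiHeatRayIntegrand
  fun_prop

/-- The point `σ + iT + u` is `(σ + u) + iT`. [folklore] -/
theorem ray_point_eq (σ T u : ℝ) : (σ : ℂ) + T * I + u = ((σ + u : ℝ) : ℂ) + T * I := by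
  push_cast; ring

/-- The model scale at the Laplace point: `K = e^{-u₀²/t} ξ(σ + u₀ + iT)`. [folklore] -/
def xiLaplaceScale (t T σ : ℝ) : ℂ :=
  (Real.exp (-(xiLaplacePt t T ^ 2 / t)) : ℂ) * riemannXi (((σ + xiLaplacePt t T : ℝ) : ℂ) + T * I)

/-- `K ≠ 0` as soon as `σ + u₀ ≥ 1` (`ξ` has no zeros on `Re ≥ 1`). [folklore] -/
theorem xiLaplaceScale_ne_zero {t T σ : ℝ} (h : 1 ≤ σ + xiLaplacePt t T) : xiLaplaceScale t T σ ≠ 0 := by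
  refine mul_ne_zero (by exact_mod_cast (Real.exp_pos _).ne') ?_
  exact riemannXi_ne_zero_of_one_le_re (by simpa using h)

/-- **The exponential bookkeeping at the Laplace point**: for real `u` and complex `ρ`,
`e^{-u²/t} · exp(κ_T (u − u₀) + ρ) = e^{-u₀²/t} · exp(−(u−u₀)²/t + iπ(u−u₀)/4 + ρ)`. [folklore] -/
theorem exp_weight_mul_exp_model {t : ℝ} (ht : t ≠ 0) (T u : ℝ) (ρ : ℂ) :
    (Real.exp (-u ^ 2 / t) : ℂ) * cexp (xiLogDerivModel T * (u - xiLaplacePt t T : ℝ) + ρ) =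
      (Real.exp (-(xiLaplacePt t T ^ 2 / t)) : ℂ) *
        cexp (-(((u - xiLaplacePt t T) ^ 2 / t : ℝ) : ℂ) +
          ((π / 4 * (u - xiLaplacePt t T) : ℝ) : ℂ) * I + ρ) := by
  rw [Complex.ofReal_exp, Complex.ofReal_exp, ← Complex.exp_add, ← Complex.exp_add]
  congr 1
  have h := congrArg (fun x : ℝ ↦ (x : ℂ)) (laplacePt_complete_square ht T u)
  push_cast at h ⊢
  rw [xiLogDerivModel_eq_ell]
  push_cast
  linear_combination h

/-- `‖K‖ = e^{-u₀²/t} |ξ(σ + u₀ + iT)|`. [folklore] -/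
theorem norm_xiLaplaceScale (t T σ : ℝ) : ‖xiLaplaceScale t T σ‖ =
    Real.exp (-(xiLaplacePt t T ^ 2 / t)) * ‖riemannXi (((σ + xiLaplacePt t T : ℝ) : ℂ) + T * I)‖ := by
  rw [xiLaplaceScale, norm_mul, Complex.norm_real, Real.norm_eq_abs, abs_of_pos (Real.exp_pos _)]

/-! ## Two-point control read at the Laplace point -/

/-- **Right of the Laplace point.** For `T ≥ 5`, `c = σ + u₀ ≥ 5` and `u ≥ u₀` (`y = u − u₀ ≥ 0`):
`e^{-u²/t} ξ(σ+u+iT) = K exp(−y²/t + iπy/4 + ρ)` with `‖ρ‖ ≤ y (η_T + (c + y)/(2T))`.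
[folklore] -/
theorem xiHeatRayIntegrand_eq_of_laplacePt_le {t T σ u : ℝ} (ht : 0 < t) (hT : 5 ≤ T)
    (hc : 5 ≤ σ + xiLaplacePt t T) (hu : xiLaplacePt t T ≤ u) :
    ∃ ρ : ℂ, ‖ρ‖ ≤ (u - xiLaplacePt t T) *
        (xiRayErr T + (σ + xiLaplacePt t T + (u - xiLaplacePt t T)) / (2 * T)) ∧
      xiHeatRayIntegrand t T σ u = xiLaplaceScale t T σ *
        cexp (-(((u - xiLaplacePt t T) ^ 2 / t : ℝ) : ℂ) +
          ((π / 4 * (u - xiLaplacePt t T) : ℝ) : ℂ) * I + ρ) := by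
  obtain ⟨ρ, hρ, heq⟩ := riemannXi_horizontal_two_point (T := T) (v₀ := σ + xiLaplacePt t T)
    (a := u - xiLaplacePt t T) hT hc (by linarith)
  refine ⟨ρ, hρ, ?_⟩
  rw [xiHeatRayIntegrand, ray_point_eq, show σ + u = σ + xiLaplacePt t T + (u - xiLaplacePt t T) by ring,
    heq, mul_left_comm, exp_weight_mul_exp_model ht.ne', xiLaplaceScale]
  ring

/-- **Left of the Laplace point.** For `T ≥ 5`, `σ + u ≥ 5` and `u ≤ u₀` (`y = u − u₀ ≤ 0`):
`e^{-u²/t} ξ(σ+u+iT) = K exp(−y²/t + iπy/4 + ρ)` with `‖ρ‖ ≤ |y| (η_T + c/(2T))`, `c = σ + u₀`.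
[folklore] -/
theorem xiHeatRayIntegrand_eq_of_le_laplacePt {t T σ u : ℝ} (ht : 0 < t) (hT : 5 ≤ T)
    (h5 : 5 ≤ σ + u) (hu : u ≤ xiLaplacePt t T) :
    ∃ ρ : ℂ, ‖ρ‖ ≤ (xiLaplacePt t T - u) * (xiRayErr T + (σ + xiLaplacePt t T) / (2 * T)) ∧
      xiHeatRayIntegrand t T σ u = xiLaplaceScale t T σ *
        cexp (-(((u - xiLaplacePt t T) ^ 2 / t : ℝ) : ℂ) +
          ((π / 4 * (u - xiLaplacePt t T) : ℝ) : ℂ) * I + ρ) := by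
  obtain ⟨ρ, hρ, heq⟩ := riemannXi_horizontal_two_point' (T := T) (v₀ := σ + u)
    (a := xiLaplacePt t T - u) hT h5 (by linarith)
  refine ⟨ρ, ?_, ?_⟩
  · simpa [show σ + u + (xiLaplacePt t T - u) = σ + xiLaplacePt t T by ring] using hρ
  rw [xiHeatRayIntegrand, ray_point_eq, heq,
    show σ + u + (xiLaplacePt t T - u) = σ + xiLaplacePt t T by ring]
  have e : -(xiLogDerivModel T * ((xiLaplacePt t T - u : ℝ) : ℂ)) + ρ =
      xiLogDerivModel T * ((u - xiLaplacePt t T : ℝ) : ℂ) + ρ := by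
    push_cast; ring
  rw [e, mul_left_comm, exp_weight_mul_exp_model ht.ne', xiLaplaceScale]
  ring

/-! ## The window `|u − u₀| ≤ Y` -/

/-- **On the window.** For `T ≥ 5`, `σ ≥ 0`, `c = σ + u₀ ≥ 5`, `u > 5` and `|u − u₀| ≤ Y`:
`e^{-u²/t} ξ(σ+u+iT) = K exp(−y²/t + iπy/4 + ρ)` with `‖ρ‖ ≤ η₂ |y|`, `η₂ = η_T + (c + Y)/(2T)`.
[folklore] -/
theorem xiHeatRayIntegrand_window {t T σ Y u : ℝ} (ht : 0 < t) (hT : 5 ≤ T) (hσ : 0 ≤ σ)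
    (hY : 0 ≤ Y) (hc : 5 ≤ σ + xiLaplacePt t T) (hu : 5 < u) (hwin : |u - xiLaplacePt t T| ≤ Y) :
    ∃ ρ : ℂ, ‖ρ‖ ≤ (xiRayErr T + (σ + xiLaplacePt t T + Y) / (2 * T)) * |u - xiLaplacePt t T| ∧
      xiHeatRayIntegrand t T σ u = xiLaplaceScale t T σ *
        cexp (-(((u - xiLaplacePt t T) ^ 2 / t : ℝ) : ℂ) +
          ((π / 4 * (u - xiLaplacePt t T) : ℝ) : ℂ) * I + ρ) := by
  have hT0 : 0 < T := by linarith
  have hη : 0 ≤ xiRayErr T := xiRayErr_nonneg hT0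
  have hc0 : 0 ≤ σ + xiLaplacePt t T := by linarith
  rcases le_or_gt (xiLaplacePt t T) u with hle | hlt
  · obtain ⟨ρ, hρ, heq⟩ := xiHeatRayIntegrand_eq_of_laplacePt_le (σ := σ) ht hT hc hle
    refine ⟨ρ, hρ.trans ?_, heq⟩
    have hy0 : 0 ≤ u - xiLaplacePt t T := by linarith
    rw [abs_of_nonneg hy0] at hwin ⊢
    rw [mul_comm]
    gcongr
  · obtain ⟨ρ, hρ, heq⟩ := xiHeatRayIntegrand_eq_of_le_laplacePt (σ := σ) ht hT (by linarith) hlt.le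
    refine ⟨ρ, hρ.trans ?_, heq⟩
    have hy0 : u - xiLaplacePt t T < 0 := by linarith
    calc (xiLaplacePt t T - u) * (xiRayErr T + (σ + xiLaplacePt t T) / (2 * T))
        ≤ (xiLaplacePt t T - u) * (xiRayErr T + (σ + xiLaplacePt t T + Y) / (2 * T)) := by
          have : (σ + xiLaplacePt t T) / (2 * T) ≤ (σ + xiLaplacePt t T + Y) / (2 * T) :=
            div_le_div_of_nonneg_right (by linarith) (by positivity)
          exact mul_le_mul_of_nonneg_left (by linarith) (by linarith)
      _ = (xiRayErr T + (σ + xiLaplacePt t T + Y) / (2 * T)) * |u - xiLaplacePt t T| := by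
          rw [abs_of_neg hy0]; ring

/-- The Gaussian absorption of a linear exponent: `-y²/t + η|y| ≤ η²t − 3y²/(4t)`. [folklore] -/
theorem neg_sq_div_add_mul_abs_le {t : ℝ} (ht : 0 < t) (η y : ℝ) :
    -(y ^ 2 / t) + η * |y| ≤ η ^ 2 * t - y ^ 2 / (4 * t / 3) := by
  have h4 : y ^ 2 / (4 * t / 3) = 3 * y ^ 2 / (4 * t) := by field_simp
  rw [h4]
  have key : η * |y| ≤ η ^ 2 * t + y ^ 2 / (4 * t) := by
    have h : 0 ≤ (2 * t * η - |y|) ^ 2 / (4 * t) := by positivity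
    have e : (2 * t * η - |y|) ^ 2 / (4 * t) = η ^ 2 * t - η * |y| + y ^ 2 / (4 * t) := by
      field_simp
      linear_combination sq_abs y
    linarith
  have e2 : -(y ^ 2 / t) + (η ^ 2 * t + y ^ 2 / (4 * t)) = η ^ 2 * t - 3 * y ^ 2 / (4 * t) := by
    field_simp; ring
  linarith

/-- **Size on the window**: under the hypotheses of `xiHeatRayIntegrand_window`,
`‖e^{-u²/t} ξ(σ+u+iT)‖ ≤ ‖K‖ e^{η₂² t} e^{-3(u−u₀)²/(4t)}`. [folklore] -/
theorem norm_xiHeatRayIntegrand_le_of_window {t T σ Y u : ℝ} (ht : 0 < t) (hT : 5 ≤ T) (hσ : 0 ≤ σ)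
    (hY : 0 ≤ Y) (hc : 5 ≤ σ + xiLaplacePt t T) (hu : 5 < u) (hwin : |u - xiLaplacePt t T| ≤ Y) :
    ‖xiHeatRayIntegrand t T σ u‖ ≤ ‖xiLaplaceScale t T σ‖ *
      (Real.exp ((xiRayErr T + (σ + xiLaplacePt t T + Y) / (2 * T)) ^ 2 * t) *
        Real.exp (-((u - xiLaplacePt t T) ^ 2 / (4 * t / 3)))) := by
  obtain ⟨ρ, hρ, heq⟩ := xiHeatRayIntegrand_window ht hT hσ hY hc hu hwin
  set η₂ := xiRayErr T + (σ + xiLaplacePt t T + Y) / (2 * T)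
  set y := u - xiLaplacePt t T
  rw [heq, norm_mul, norm_cexp_gaussian_phase, ← Real.exp_add]
  refine mul_le_mul_of_nonneg_left (Real.exp_le_exp.2 ?_) (norm_nonneg _)
  calc -(y ^ 2 / t) + ρ.re ≤ -(y ^ 2 / t) + η₂ * |y| := by
        gcongr; exact (Complex.re_le_norm ρ).trans hρ
    _ ≤ η₂ ^ 2 * t - y ^ 2 / (4 * t / 3) := neg_sq_div_add_mul_abs_le ht η₂ y
    _ = η₂ ^ 2 * t + -(y ^ 2 / (4 * t / 3)) := by ring

/-- **Model fit on the window**: under the hypotheses of `xiHeatRayIntegrand_window`,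
`‖e^{-u²/t} ξ(σ+u+iT) − K e^{-(u−u₀)²/t + iπ(u−u₀)/4}‖ ≤ ‖K‖ η₂ e^{η₂² t} |u−u₀| e^{-3(u−u₀)²/(4t)}`.
[folklore] -/
theorem norm_xiHeatRayIntegrand_sub_model_le_of_window {t T σ Y u : ℝ} (ht : 0 < t) (hT : 5 ≤ T)
    (hσ : 0 ≤ σ) (hY : 0 ≤ Y) (hc : 5 ≤ σ + xiLaplacePt t T) (hu : 5 < u)
    (hwin : |u - xiLaplacePt t T| ≤ Y) :
    ‖xiHeatRayIntegrand t T σ u - xiLaplaceScale t T σ *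
        cexp (-(((u - xiLaplacePt t T) ^ 2 / t : ℝ) : ℂ) + ((π / 4 * (u - xiLaplacePt t T) : ℝ) : ℂ) * I)‖ ≤
      ‖xiLaplaceScale t T σ‖ * ((xiRayErr T + (σ + xiLaplacePt t T + Y) / (2 * T)) *
        Real.exp ((xiRayErr T + (σ + xiLaplacePt t T + Y) / (2 * T)) ^ 2 * t) *
        (|u - xiLaplacePt t T| * Real.exp (-((u - xiLaplacePt t T) ^ 2 / (4 * t / 3))))) := by
  obtain ⟨ρ, hρ, heq⟩ := xiHeatRayIntegrand_window ht hT hσ hY hc hu hwin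
  set η₂ := xiRayErr T + (σ + xiLaplacePt t T + Y) / (2 * T) with hη₂
  set y := u - xiLaplacePt t T
  have hT0 : 0 < T := by linarith
  have hη₂0 : 0 ≤ η₂ := by
    have := xiRayErr_nonneg hT0
    have : 0 ≤ σ + xiLaplacePt t T := by linarith
    positivity
  set g : ℂ := -((y ^ 2 / t : ℝ) : ℂ) + ((π / 4 * y : ℝ) : ℂ) * I with hg
  have hsplit : xiLaplaceScale t T σ * cexp (g + ρ) - xiLaplaceScale t T σ * cexp g =
      xiLaplaceScale t T σ * cexp g * (cexp ρ - 1) := by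
    rw [Complex.exp_add]; ring
  rw [heq, hsplit, norm_mul, norm_mul, mul_assoc]
  refine mul_le_mul_of_nonneg_left ?_ (norm_nonneg _)
  have hg' : ‖cexp g‖ = Real.exp (-(y ^ 2 / t)) := by
    have := norm_cexp_gaussian_phase t (π / 4) y 0
    simpa [hg] using this
  rw [hg']
  have h1 : ‖cexp ρ - 1‖ ≤ η₂ * |y| * Real.exp (η₂ * |y|) := by
    refine (norm_cexp_sub_one_le_mul_exp ρ).trans ?_
    gcongr
  calc Real.exp (-(y ^ 2 / t)) * ‖cexp ρ - 1‖
      ≤ Real.exp (-(y ^ 2 / t)) * (η₂ * |y| * Real.exp (η₂ * |y|)) := by gcongr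
    _ = η₂ * |y| * Real.exp (-(y ^ 2 / t) + η₂ * |y|) := by rw [Real.exp_add]; ring
    _ ≤ η₂ * |y| * Real.exp (η₂ ^ 2 * t - y ^ 2 / (4 * t / 3)) := by
        gcongr; exact neg_sq_div_add_mul_abs_le ht η₂ y
    _ = η₂ * Real.exp (η₂ ^ 2 * t) * (|y| * Real.exp (-(y ^ 2 / (4 * t / 3)))) := by
        rw [sub_eq_add_neg, Real.exp_add]; ring

/-! ## Beyond the window -/

/-- **The tail `u − u₀ ≥ Y`**: for `T ≥ 5`, `T ≥ 2t`, `5 ≤ c = σ + u₀ ≤ 2T`, and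
`Y ≥ 4t(η_T + 1)`: `‖e^{-u²/t} ξ(σ+u+iT)‖ ≤ ‖K‖ e^{-(u−u₀)²/(2t)}` whenever `u − u₀ ≥ Y`.
[folklore] -/
theorem norm_xiHeatRayIntegrand_le_of_tail {t T σ Y u : ℝ} (ht : 0 < t) (hT : 5 ≤ T)
    (htT : 2 * t ≤ T) (hc : 5 ≤ σ + xiLaplacePt t T) (hcT : σ + xiLaplacePt t T ≤ 2 * T)
    (hY : 4 * t * (xiRayErr T + 1) ≤ Y) (hu : Y ≤ u - xiLaplacePt t T) :
    ‖xiHeatRayIntegrand t T σ u‖ ≤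
      ‖xiLaplaceScale t T σ‖ * Real.exp (-((u - xiLaplacePt t T) ^ 2 / (2 * t))) := by
  have hT0 : 0 < T := by linarith
  have hη : 0 ≤ xiRayErr T := xiRayErr_nonneg hT0
  have hY0 : 0 ≤ Y := le_trans (by positivity) hY
  set y := u - xiLaplacePt t T with hy
  have hy0 : 0 ≤ y := hY0.trans hu
  obtain ⟨ρ, hρ, heq⟩ := xiHeatRayIntegrand_eq_of_laplacePt_le (σ := σ) ht hT hc (by linarith)
  rw [heq, norm_mul, norm_cexp_gaussian_phase]
  gcongr
  have hre : ρ.re ≤ y * (xiRayErr T + (σ + xiLaplacePt t T + y) / (2 * T)) :=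
    (Complex.re_le_norm ρ).trans hρ
  -- `y (η + c/(2T)) ≤ y²/(4t)` and `y²/(2T) ≤ y²/(4t)`
  have h1 : (σ + xiLaplacePt t T) / (2 * T) ≤ 1 := by
    rw [div_le_one (by positivity)]; exact hcT
  have h2 : y * (xiRayErr T + (σ + xiLaplacePt t T) / (2 * T)) ≤ y ^ 2 / (4 * t) := by
    have : xiRayErr T + (σ + xiLaplacePt t T) / (2 * T) ≤ y / (4 * t) := by
      rw [le_div_iff₀ (by positivity)]; nlinarith
    calc y * (xiRayErr T + (σ + xiLaplacePt t T) / (2 * T)) ≤ y * (y / (4 * t)) := by gcongr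
      _ = y ^ 2 / (4 * t) := by ring
  have h3 : y * (y / (2 * T)) ≤ y ^ 2 / (4 * t) := by
    rw [show y * (y / (2 * T)) = y ^ 2 / (2 * T) by ring]
    exact div_le_div_of_nonneg_left (sq_nonneg y) (by positivity) (by linarith)
  have e : y * (xiRayErr T + (σ + xiLaplacePt t T + y) / (2 * T)) =
      y * (xiRayErr T + (σ + xiLaplacePt t T) / (2 * T)) + y * (y / (2 * T)) := by ring
  have e2 : -(y ^ 2 / t) + (y ^ 2 / (4 * t) + y ^ 2 / (4 * t)) = -(y ^ 2 / (2 * t)) := by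
    field_simp; ring
  linarith

/-! ## The strip scale against the Laplace scale -/

/-- **`ξ` at abscissa `σ + 5` is negligible against `K`**: for `T ≥ 5`, `σ ≥ 0`, `u₀ ≥ 5`,
`|ξ(σ + 5 + iT)| ≤ ‖K‖ · exp(u₀²/t − (u₀ − 5)(ℓ_T − η_T − (σ + u₀)/(2T)))` (the lower two-point
bound `Literature.NumberTheory.LFunctions.le_norm_riemannXi_horizontal` from `σ + 5` to `c = σ + u₀`).
[folklore] -/
theorem norm_riemannXi_five_le_laplace {t T σ : ℝ} (hT : 5 ≤ T) (hσ : 0 ≤ σ)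
    (hu₀ : 5 ≤ xiLaplacePt t T) :
    ‖riemannXi (((σ + 5 : ℝ) : ℂ) + T * I)‖ ≤ ‖xiLaplaceScale t T σ‖ *
      Real.exp (xiLaplacePt t T ^ 2 / t - (xiLaplacePt t T - 5) *
        (xiRayEll T - xiRayErr T - (σ + xiLaplacePt t T) / (2 * T))) := by
  set u₀ := xiLaplacePt t T with hu₀'
  have h := le_norm_riemannXi_horizontal (T := T) (v₀ := σ + 5) (a := u₀ - 5) hT (by linarith) (by linarith)
  rw [show σ + 5 + (u₀ - 5) = σ + u₀ by ring] at h
  rw [norm_xiLaplaceScale]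
  set E := Real.log (T / (2 * π)) / 2 * (u₀ - 5) - (u₀ - 5) * (xiRayErr T + (σ + u₀) / (2 * T)) with hE
  have hE' : -(u₀ ^ 2 / t) + (u₀ ^ 2 / t - (u₀ - 5) * (xiRayEll T - xiRayErr T - (σ + u₀) / (2 * T))) = -E := by
    rw [hE, xiRayEll]; ring
  calc ‖riemannXi (((σ + 5 : ℝ) : ℂ) + T * I)‖
      = ‖riemannXi (((σ + 5 : ℝ) : ℂ) + T * I)‖ * Real.exp E * Real.exp (-E) := by
        rw [mul_assoc, ← Real.exp_add, add_neg_cancel, Real.exp_zero, mul_one]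
    _ ≤ ‖riemannXi (((σ + u₀ : ℝ) : ℂ) + T * I)‖ * Real.exp (-E) := by gcongr
    _ = _ := by rw [← hE', Real.exp_add]; ring

end Literature.NumberTheory.LFunctions

namespace Literature.NumberTheory.LFunctions

/-! ## Quantities of the Laplace analysis

The remaining definitions used by `XiHeatRayLaplace.lean` and `XiHeatRayMonotone.lean`: the two
parts of the ray integral, the Gaussian-phase model, the dominating profiles and their rates, the
brackets `m`, `i`, `n` of the final inequality, and the two hypothesis bundles. -/

/-- The initial part `∫_0^5 e^{-u²/t} ξ(σ+u+iT) du` of `𝒜_t(σ + iT)`. [folklore] -/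
def xiHeatRayInit (t T σ : ℝ) : ℂ := ∫ u in (0 : ℝ)..5, xiHeatRayIntegrand t T σ u

/-- The main part `∫_5^∞ e^{-u²/t} ξ(σ+u+iT) du` of `𝒜_t(σ + iT)`. [folklore] -/
def xiHeatRayMain (t T σ : ℝ) : ℂ := ∫ u in Ioi (5 : ℝ), xiHeatRayIntegrand t T σ u

/-- The model `K e^{-(u−u₀)²/t + iπ(u−u₀)/4}` of the integrand near the Laplace point. [folklore] -/
def xiHeatRayModel (t T σ u : ℝ) : ℂ :=
  xiLaplaceScale t T σ *
    cexp (-(((u - xiLaplacePt t T) ^ 2 / t : ℝ) : ℂ) + ((π / 4 * (u - xiLaplacePt t T) : ℝ) : ℂ) * I)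

/-- The window error rate `η₂ = η_T + (σ + 2u₀ − 5)/(2T)` (`= η_T + (c + Y)/(2T)` with
`c = σ + u₀`, `Y = u₀ − 5`). [folklore] -/
def xiWindowErr (t T σ : ℝ) : ℝ := xiRayErr T + (σ + xiLaplacePt t T + (xiLaplacePt t T - 5)) / (2 * T)

/-- The dominating profile `b(u) = η₂ e^{η₂²t} |u−u₀| e^{-3(u−u₀)²/(4t)} + 2 e^{-Y²/(4t)} e^{-(u−u₀)²/(4t)}`.
[folklore] -/
def xiWindowBound (t T σ u : ℝ) : ℝ :=
  xiWindowErr t T σ * Real.exp (xiWindowErr t T σ ^ 2 * t) *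
      (|u - xiLaplacePt t T| * Real.exp (-((u - xiLaplacePt t T) ^ 2 / (4 * t / 3)))) +
    2 * Real.exp (-((xiLaplacePt t T - 5) ^ 2 / (4 * t))) *
      Real.exp (-((u - xiLaplacePt t T) ^ 2 / (4 * t)))

/-- Standing hypotheses of the Laplace analysis at `(t, T, σ)`: `0 < t`, `T ≥ 5`, `T ≥ 2t`,
`0 ≤ σ`, the Laplace point satisfies `u₀ ≥ 5 + 4t(η_T + 1)` (so the window half-width
`Y = u₀ − 5` absorbs the linear exponent) and `σ + u₀ + 1 ≤ 2T`. [folklore] -/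
structure LaplaceHyp (t T σ : ℝ) : Prop where
  t_pos : 0 < t
  five_le : 5 ≤ T
  two_t_le : 2 * t ≤ T
  σ_nonneg : 0 ≤ σ
  σ_le_one : σ ≤ 1
  window : 5 + 4 * t * (xiRayErr T + 1) ≤ xiLaplacePt t T
  c_le' : σ + xiLaplacePt t T + 1 ≤ 2 * T

/-- The rate `η₃ = η_T + (σ + 2u₀ − 4)/(2T)` bounding `η_T + (σ + u + 1)/(2T)` on the window. [folklore] -/
def xiWindowErr' (t T σ : ℝ) : ℝ := xiRayErr T + (σ + xiLaplacePt t T + (xiLaplacePt t T - 5) + 1) / (2 * T)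

/-- The dominating profile for the difference of main parts:
`b₂(u) = η₃ e^{η₃ + η₂²t} e^{-3(u−u₀)²/(4t)} + e^{2η_T + 2 − Y²/(8t)} e^{-(u−u₀)²/(8t)}`. [folklore] -/
def xiDiffBound (t T σ u : ℝ) : ℝ :=
  xiWindowErr' t T σ * Real.exp (xiWindowErr' t T σ + xiWindowErr t T σ ^ 2 * t) *
      Real.exp (-((u - xiLaplacePt t T) ^ 2 / (4 * t / 3))) +
    Real.exp (2 * xiRayErr T + 2 - (xiLaplacePt t T - 5) ^ 2 / (8 * t)) *
      Real.exp (-((u - xiLaplacePt t T) ^ 2 / (8 * t)))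

/-- The integrand of the initial part in the variable `v = σ + u`:
`g_σ(v) = e^{-(v−σ)²/t} ξ(v + iT)`. [folklore] -/
def xiInitIntegrand (t T σ v : ℝ) : ℂ :=
  (Real.exp (-(v - σ) ^ 2 / t) : ℂ) * riemannXi ((v : ℂ) + T * I)

/-- The strip scale `B = 300 T |ξ(σ + 5 + iT)|`. [folklore] -/
def xiStripScale (T σ : ℝ) : ℝ := 300 * T * ‖riemannXi (((σ + 5 : ℝ) : ℂ) + T * I)‖

/-- The Laplace lower-bound bracket `m = √(πt) e^{-π²t/64} − (4t/3) η₂ e^{η₂²t} − 2√(4πt) e^{-Y²/(4t)} − √(2πt) e^{-Y²/(2t)}`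
(`‖𝒜^main‖ ≥ ‖K‖ m`, `Literature.NumberTheory.LFunctions.norm_xiHeatRayMain_ge`). [folklore] -/
def xiMainLower (t T σ : ℝ) : ℝ :=
  Real.sqrt (π * t) * Real.exp (-(π ^ 2 * t / 64)) -
    (xiWindowErr t T σ * Real.exp (xiWindowErr t T σ ^ 2 * t) * (4 * t / 3) +
      2 * Real.exp (-((xiLaplacePt t T - 5) ^ 2 / (4 * t))) * Real.sqrt (π * (4 * t))) -
    Real.exp (-((xiLaplacePt t T - 5) ^ 2 / (2 * t))) * Real.sqrt (π * (2 * t))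

/-- The difference bracket `i = ∫_ℝ b₂ = η₃ e^{η₃ + η₂²t} √(4πt/3) + e^{2η_T + 2 − Y²/(8t)} √(8πt)`
(`‖𝒜^main(σ₂) − e^{κδ}𝒜^main(σ₁)‖ ≤ e^{ℓδ} δ ‖K‖ i`). [folklore] -/
def xiDiffInt (t T σ : ℝ) : ℝ :=
  xiWindowErr' t T σ * Real.exp (xiWindowErr' t T σ + xiWindowErr t T σ ^ 2 * t) * Real.sqrt (π * (4 * t / 3)) +
    Real.exp (2 * xiRayErr T + 2 - (xiLaplacePt t T - 5) ^ 2 / (8 * t)) * Real.sqrt (π * (8 * t))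

/-- The initial-part rate `n = 60/t + 2 + 5e(ℓ_T + 1)`
(`‖𝒜^init(σ₂) − e^{κδ}𝒜^init(σ₁)‖ ≤ δ e^{ℓδ} B n`). [folklore] -/
def xiInitRate (t T : ℝ) : ℝ := 60 / t + 2 + 5 * Real.exp 1 * (xiRayEll T + 1)

/-- Standing hypotheses of the final assembly: `0 < t ≤ 1/2`, `T > 0`, and the Laplace point
`u₀ = t ℓ_T / 2 ≥ 20` (i.e. `T ≥ 2π e^{80/t}`). [folklore] -/
structure RegimeHyp (t T : ℝ) : Prop where
  t_pos : 0 < t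
  t_le : t ≤ 1 / 2
  T_pos : 0 < T
  laplacePt : 20 ≤ xiLaplacePt t T

end Literature.NumberTheory.LFunctions

end
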